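/-
Copyright (c) 2026 the pub-hodgecm-mathlib formalisation cell (harness21).  Prover seat hodgecm-mathlib-K2Liu-p27 (g0), Track B «K2-LIT»,
#184♮ = hLiu418 = `stmt-HodgeConjecture-24832`; #42S organ S2, (B) CONJUGACY, file B3 (the bridge to the sign-frame ∕ place-section currencies)
(desk K2Liu-p05 (g6) 2026-09-04T15:46:57Z «YES take B3»; LEAD F0P6-plan (g14) BATCH #45–#49).
-/
import Summits.HodgeConjecture.HodgeConjecture.Theorems.K2LiuStdArchCompactConjugate      -- ★ B2 `exists_conj_archCompact` (the sign-block currency)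
import Summits.HodgeConjecture.HodgeConjecture.Theorems.K2LiuArchTensorPlaceSec           -- ★ `exists_cmPlaceOver_eq`, `archUFormPi_injective_cm` (+ ★ `placeSec`, `archUFormPi_placeSec`)
import Literature.NumberTheory.Weil1964.ArchUnitaryWeilHalfCompactBlock                  -- ★ `UForm.exists_eq_kV_of_toBlocks_eq_zero`
import HarnessLib

/-!
# Crux `HLiu418`, #42S organ S2, (B) file B3: SIGN-BLOCK-DIAGONAL ⟺ IN `kV`'S RANGE AT EVERY REAL PLACE ⟺ IN THE SUBMONOID GENERATED BY THE PLACE SECTIONS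
# (the bridge from ★ B2's `K_diag` currency to σ15's ∕ ★ p861314's `Submonoid.closure {placeSec σ (kV k₁)}` and to p16's `archUFormPi … ∈ (kV).range`)

Cell `hodgecm-mathlib`, crux item hLiu418 = `stmt-HodgeConjecture-24832`; squad K2 ∕ K2Liu; LEAD F0P6-plan (g14), co-dealer K2E5-plan (g7), S2 desk K2Liu-p05 (g6); prover
K2Liu-p27 (g0).  THEOREMS ONLY (no `def`, no instance, no notation, no named-fact hypothesis, no `sorry`); lane `--supports stmt-HodgeConjecture-24832 --as helper`.

WHY (desk 15:46:57Z).  ★ B2 `K2LiuStdArchCompactConjugate.exists_conj_archCompact` delivers, for every STANDARD Iwasawa datum, `g ∈ H(L⁺ ⊗ ℝ)` with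
`(a, 1_f) ∈ 𝒦.K ↔ SignBlock (g⁻¹ a g)`, where `SignBlock x` := «at every complex place `w`, `(x_w) i j = 0` whenever the real diagonal entries `σ_w(J^𝔻_{ii})`,
`σ_w(J^𝔻_{jj})` have opposite signs».  The (B′) wrapper (K2Liu-p23) and the final assembly (F0P2-p08) speak two other dialects of the same compact `K_diag`:
p16's `∀ σ, archUFormPi x σ ∈ (UForm.kV (PosIdx x_σ) (NegIdx x_σ)).range` (`hk1`, ★ `K2LiuArchReadingFrameKdiag.fr_mem_kV_range`) and σ15's ∕ ★ p861314's
`x ∈ Submonoid.closure {placeSec σ (kV k₁)}` (`hK₀`).  This file proves the three are EQUIVALENT for the CM datum: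
* §1 (generic `U(α, β)`): `mem_kV_range_iff_toBlocks` — `u ∈ (kV α β).range ↔ u₁₂ = 0 ∧ u₂₁ = 0` (★ `UForm.exists_eq_kV_of_toBlocks_eq_zero`).
* §2 `signBlock_iff_archUFormPi_mem_range` — SignBlock ↔ the `kV`-range clause (★ `coe_archUForm` = `reindex (signSplit x_σ) (scaleConj √|x_σ| ·)`, `x_σ j = σ(t₀ j)∕c_σ`,
  every complex place is a `cmPlaceOver σ` ★ `exists_cmPlaceOver_eq`).
* §3 `archUFormPi_mem_range_iff_mem_closure` — the `kV`-range clause ↔ the place-section closure (★ `archUFormPi_placeSec` = `Pi.mulSingle`; the product of the place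
  sections over the real places, ★ `archUFormPi_injective_cm`, Mathlib `Finset.noncommProd_mulSingle`).
* §4 `signBlock_iff_mem_closure` — the composite, the form the wrapper consumes with ★ B2.
References: [Weil1964] Chap. I n° 8; [BorelJacquet1979] §4.1; [KonnoKonno2007] §3.1; [Folland1989] §4.2 Prop. (4.39).
HONEST LABEL.  Count-neutral helper: `HC_CM` is proved only modulo the 7 printed citations (2 remaining named inputs: hLiu418 = `stmt-HodgeConjecture-24832`,
h413 = `stmt-HodgeConjecture-24833`) until rung 0 closes; this file closes no socket.
-/

set_option autoImplicit false
set_option linter.dupNamespace false -- the mandated namespace repeats `HodgeConjecture.HodgeConjecture`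

noncomputable section

open scoped Matrix Classical
open NumberField NumberField.InfinitePlace NumberField.mixedEmbedding IsDedekindDomain
open Literature.NumberTheory.Automorphic Literature.NumberTheory.Automorphic.UnitaryGroup Literature.NumberTheory.Weil1964
open Literature.NumberTheory.GelbartRogawski1991 Literature.NumberTheory.GelbartRogawski1991.UnitaryDualPair
open Literature.NumberTheory.GelbartRogawski1991.UnitaryDualPair.LocalSplitting
open Literature.NumberTheory.GelbartRogawski1991.GRConstruction Literature.NumberTheory.K2Lit.SiegelDoubled
open Literature.RepresentationTheory.KonnoKonno2007 Literature.RepresentationTheory.KonnoKonno2007.RealDualPair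
open Summit.HodgeConjecture.HodgeConjecture.Cruxes.HLiu418 Summit.HodgeConjecture.HodgeConjecture.Cruxes.HLiu418.K2LiuArchSectionPlaceBlock
open Summit.HodgeConjecture.HodgeConjecture.Cruxes.HLiu418.K2LiuArchTensorPlaceSec

namespace Summit.HodgeConjecture.HodgeConjecture.Cruxes.HLiu418.K2LiuSignBlockCompactPlaceSec

/-! ## §1 Generic: the range of `kV : U(α) × U(β) →* U(α, β)` is the block-diagonal subgroup -/

section Generic

variable {α β : Type*} [Fintype α] [DecidableEq α] [Fintype β] [DecidableEq β]

/-- **`u ∈ (kV α β).range ↔` the off-diagonal blocks of `u` vanish** (★ `UForm.exists_eq_kV_of_toBlocks_eq_zero`; `kV (a,b) = diag(a,b)`).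
[cite: Folland1989, §4.2 Prop. (4.39)] [cite: KonnoKonno2007, §3.1] -/
theorem mem_kV_range_iff_toBlocks (u : UForm α β) :
    u ∈ (UForm.kV α β).range ↔
      (((u : UForm α β) : GL (α ⊕ β) ℂ) : Matrix (α ⊕ β) (α ⊕ β) ℂ).toBlocks₁₂ = 0 ∧
        (((u : UForm α β) : GL (α ⊕ β) ℂ) : Matrix (α ⊕ β) (α ⊕ β) ℂ).toBlocks₂₁ = 0 := by
  constructor
  · rintro ⟨k, rfl⟩
    rw [UForm.coe_kV, Matrix.toBlocks_fromBlocks₁₂, Matrix.toBlocks_fromBlocks₂₁]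
    exact ⟨rfl, rfl⟩
  · rintro ⟨h₁₂, h₂₁⟩
    obtain ⟨k, hk, -, -⟩ := UForm.exists_eq_kV_of_toBlocks_eq_zero u h₁₂ h₂₁
    exact ⟨k, hk.symm⟩

end Generic

/-! ## §2 The CM datum: SignBlock ⟺ the `kV`-range clause at every real place -/

section CM

variable (L : Type) [Field L] [NumberField L] [IsCMField L]
variable {N M n : ℕ} (e : Fin N × Fin M ≃ Fin n)
  (dV : Fin N → L) (hdV : ∀ i, IsCMField.complexConj L (dV i) = dV i) (hdV0 : ∀ i, dV i ≠ 0)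
  (dW : Fin M → L) (hdW : ∀ i, IsCMField.complexConj L (dW i) = dW i) (hdW0 : ∀ i, dW i ≠ 0)

/-- the real number behind a diagonal entry of `J^𝔻` at the place over `σ`: `re σ_{w(σ)}(J^𝔻_{kk}) = σ(t₀^𝔻 k) = c_σ · x_σ k`
(★ `embedding_algebraMap_eq_embedding_of_isReal`; `x_σ = signVec`, `c_σ = deltaIm`). [cite: KonnoKonno2007, §3.1] -/
theorem re_embedding_hermD_diag (σ : {v : InfinitePlace (Fp L) // v.IsReal}) (k : Fin (n + n)) :
    ((cmPlaceOver L σ).1.embedding (hermD L e dV hdV dW hdW k k)).re =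
      deltaIm (cmPlaceOver L) (imagUnit L) σ * signVec (cmPlaceOver L) (fun k => Sum.elim (cmGramEntry L e dV hdV dW hdW) (-cmGramEntry L e dV hdV dW hdW) ((LocalSplitting.e₂ n).symm k)) (imagUnit L) σ k := by
  have hHkk : hermD L e dV hdV dW hdW k k = algebraMap (Fp L) L ((fun k => Sum.elim (cmGramEntry L e dV hdV dW hdW) (-cmGramEntry L e dV hdV dW hdW) ((LocalSplitting.e₂ n).symm k)) k) := by
    show ((gramD L e dV hdV dW hdW).map (algebraMap (Fp L) L)) k k = _
    rw [gramD_eq_diagonal_cm, Matrix.map_apply, Matrix.diagonal_apply_eq]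
  rw [hHkk, embedding_algebraMap_eq_embedding_of_isReal L σ (cmPlaceOver L σ).1.embedding (by rw [mk_embedding]; exact cmPlaceOver_comap L σ),
    Complex.ofReal_re]
  show _ = deltaIm (cmPlaceOver L) (imagUnit L) σ * (embedding_of_isReal σ.2 ((fun k => Sum.elim (cmGramEntry L e dV hdV dW hdW) (-cmGramEntry L e dV hdV dW hdW) ((LocalSplitting.e₂ n).symm k)) k) / deltaIm (cmPlaceOver L) (imagUnit L) σ)
  rw [mul_div_cancel₀ _ (deltaIm_ne_zero (IsCMField.complexConj_ne_one L) (cmPlaceOver_smul L) (complexConj_imagUnit L) (imagUnit_ne_zero L) σ)]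

include hdV0 hdW0 in
/-- opposite signs of the diagonal entries ⟺ exactly one of the two indices is positive in the sign vector `x_σ`. [cite: KonnoKonno2007, §3.1] -/
theorem re_mul_re_neg_iff (σ : {v : InfinitePlace (Fp L) // v.IsReal}) (i j : Fin (n + n)) :
    ((cmPlaceOver L σ).1.embedding (hermD L e dV hdV dW hdW i i)).re * ((cmPlaceOver L σ).1.embedding (hermD L e dV hdV dW hdW j j)).re < 0 ↔
      ((0 < signVec (cmPlaceOver L) (fun k => Sum.elim (cmGramEntry L e dV hdV dW hdW) (-cmGramEntry L e dV hdV dW hdW) ((LocalSplitting.e₂ n).symm k)) (imagUnit L) σ i) ↔ ¬ 0 < signVec (cmPlaceOver L) (fun k => Sum.elim (cmGramEntry L e dV hdV dW hdW) (-cmGramEntry L e dV hdV dW hdW) ((LocalSplitting.e₂ n).symm k)) (imagUnit L) σ j) := by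
  have hc0 := deltaIm_ne_zero (IsCMField.complexConj_ne_one L) (cmPlaceOver_smul L) (complexConj_imagUnit L) (imagUnit_ne_zero L) σ
  have hx0 := signVec_ne_zero (IsCMField.complexConj_ne_one L) (cmPlaceOver_smul L) (complexConj_imagUnit L) (imagUnit_ne_zero L)
    (gramD_gram_realDiagonal_entry_ne_zero L e dV hdV dW hdW hdV0 hdW0) σ
  rw [re_embedding_hermD_diag, re_embedding_hermD_diag]
  set a := signVec (cmPlaceOver L) (fun k => Sum.elim (cmGramEntry L e dV hdV dW hdW) (-cmGramEntry L e dV hdV dW hdW) ((LocalSplitting.e₂ n).symm k)) (imagUnit L) σ i with ha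
  set b := signVec (cmPlaceOver L) (fun k => Sum.elim (cmGramEntry L e dV hdV dW hdW) (-cmGramEntry L e dV hdV dW hdW) ((LocalSplitting.e₂ n).symm k)) (imagUnit L) σ j with hb
  set c₀ := deltaIm (cmPlaceOver L) (imagUnit L) σ with hc
  have hcc : 0 < c₀ * c₀ := mul_self_pos.2 hc0
  have hkey : c₀ * a * (c₀ * b) < 0 ↔ a * b < 0 := by
    rw [show c₀ * a * (c₀ * b) = (c₀ * c₀) * (a * b) by ring]
    constructor
    · intro h
      by_contra h'
      exact absurd h (not_lt.2 (mul_nonneg hcc.le (not_lt.1 h')))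
    · intro h
      exact mul_neg_of_pos_of_neg hcc h
  rw [hkey]
  rcases lt_or_lt_iff_ne.2 (hx0 i) with hai | hai <;> rcases lt_or_lt_iff_ne.2 (hx0 j) with hbj | hbj
  · exact ⟨fun h => absurd h (not_lt.2 (mul_pos_of_neg_of_neg hai hbj).le), fun h => absurd (h.2 (not_lt.2 hbj.le)) (not_lt.2 hai.le)⟩
  · exact ⟨fun _ => ⟨fun ha' => absurd ha' (not_lt.2 hai.le), fun hnb => absurd hbj hnb⟩, fun _ => mul_neg_of_neg_of_pos hai hbj⟩
  · exact ⟨fun _ => ⟨fun _ => not_lt.2 hbj.le, fun _ => hai⟩, fun _ => mul_neg_of_pos_of_neg hai hbj⟩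
  · exact ⟨fun h => absurd h (not_lt.2 (mul_pos hai hbj).le), fun h => absurd hbj (h.1 hai)⟩

include hdV0 hdW0 in
/-- **the matrix of the sign-frame component**: `archUFormPi x σ = reindex ε_σ ε_σ (scaleConj √|x_σ| (x_{w(σ)}))` with `x_{w(σ)}` the place component of ★ `archPiEquivCM`
(★ `coe_archUForm`, ★ `archPart_archToAdelic`). [cite: BorelJacquet1979, §4.1] [cite: KonnoKonno2007, §3.1] -/
theorem coe_archUFormPi_eq_reindex (x : UnitaryGroup.arch (Fp L) L (IsCMField.complexConj L) (n + n) (hermD L e dV hdV dW hdW)) (σ : {v : InfinitePlace (Fp L) // v.IsReal}) :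
    (((archUFormPi L (IsCMField.complexConj L) (n + n) (IsCMField.complexConj_ne_one L) (cmPlaceOver L) (cmPlaceOver_smul L) (cmPlaceOver_comap L) (fun k => Sum.elim (cmGramEntry L e dV hdV dW hdW) (-cmGramEntry L e dV hdV dW hdW) ((LocalSplitting.e₂ n).symm k))
        (gramD_gram_realDiagonal_entry_ne_zero L e dV hdV dW hdW hdV0 hdW0) (gramD_eq_diagonal_cm L e dV hdV dW hdW) (J := hermD L e dV hdV dW hdW) rfl
        (complexConj_imagUnit L) (imagUnit_ne_zero L) x σ :
        UForm (PosIdx (signVec (cmPlaceOver L) (fun k => Sum.elim (cmGramEntry L e dV hdV dW hdW) (-cmGramEntry L e dV hdV dW hdW) ((LocalSplitting.e₂ n).symm k)) (imagUnit L) σ)) (NegIdx (signVec (cmPlaceOver L) (fun k => Sum.elim (cmGramEntry L e dV hdV dW hdW) (-cmGramEntry L e dV hdV dW hdW) ((LocalSplitting.e₂ n).symm k)) (imagUnit L) σ))) : GL (PosIdx (signVec (cmPlaceOver L) (fun k => Sum.elim (cmGramEntry L e dV hdV dW hdW) (-cmGramEntry L e dV hdV dW hdW) ((LocalSplitting.e₂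 n).symm k)) (imagUnit L) σ) ⊕ NegIdx (signVec (cmPlaceOver L) (fun k => Sum.elim (cmGramEntry L e dV hdV dW hdW) (-cmGramEntry L e dV hdV dW hdW) ((LocalSplitting.e₂ n).symm k)) (imagUnit L) σ)) ℂ) :
        Matrix (PosIdx (signVec (cmPlaceOver L) (fun k => Sum.elim (cmGramEntry L e dV hdV dW hdW) (-cmGramEntry L e dV hdV dW hdW) ((LocalSplitting.e₂ n).symm k)) (imagUnit L) σ) ⊕ NegIdx (signVec (cmPlaceOver L) (fun k => Sum.elim (cmGramEntry L e dV hdV dW hdW) (-cmGramEntry L e dV hdV dW hdW) ((LocalSplitting.e₂ n).symm k)) (imagUnit L) σ)) (PosIdx (signVec (cmPlaceOver L) (fun k => Sum.elim (cmGramEntry L e dV hdV dW hdW) (-cmGramEntry L e dV hdV dW hdW) ((LocalSplitting.e₂ n).symm k)) (imagUnit L) σ) ⊕ NegIdx (signVec (cmPlaceOver L) (fun k => Sum.elim (cmGramEntry L e dV hdV dW hdW) (-cmGramEntry L e dV hdV dW hdW) ((LocalSplitting.e₂ n).symm k)) (imagUnit L) σ)) ℂ) =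
      Matrix.reindex (signSplit (signVec (cmPlaceOver L) (fun k => Sum.elim (cmGramEntry L e dV hdV dW hdW) (-cmGramEntry L e dV hdV dW hdW) ((LocalSplitting.e₂ n).symm k)) (imagUnit L) σ)) (signSplit (signVec (cmPlaceOver L) (fun k => Sum.elim (cmGramEntry L e dV hdV dW hdW) (-cmGramEntry L e dV hdV dW hdW) ((LocalSplitting.e₂ n).symm k)) (imagUnit L) σ))
        (scaleConj (sqrtAbs (signVec (cmPlaceOver L) (fun k => Sum.elim (cmGramEntry L e dV hdV dW hdW) (-cmGramEntry L e dV hdV dW hdW) ((LocalSplitting.e₂ n).symm k)) (imagUnit L) σ)) (((UnitaryGroup.archPiEquivCM (n + n) L (hermD L e dV hdV dW hdW) x (cmPlaceOver L σ) :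
            UnitaryGroup.archLocal L (n + n) (hermD L e dV hdV dW hdW) (cmPlaceOver L σ)) : GL (Fin (n + n)) ℂ) : Matrix (Fin (n + n)) (Fin (n + n)) ℂ)) := by
  rw [archUFormPi_apply, coe_archUForm, UnitaryGroup.archPart_archToAdelic]
  rfl

include hdV0 hdW0 in
/-- **SignBlock ⟺ the `kV`-range clause.**  An archimedean element `x` has every complex-place component sign-block-diagonal (★ B2's `K_diag` currency) iff at every
real place `σ` its sign-frame component `archUFormPi x σ` lies in the range of `kV : U(P_σ) × U(Q_σ) →* U(P_σ, Q_σ)` (p16's currency).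
[cite: KonnoKonno2007, §3.1] [cite: Folland1989, §4.2 Prop. (4.39)] [cite: BorelJacquet1979, §4.1] -/
theorem signBlock_iff_archUFormPi_mem_range (x : UnitaryGroup.arch (Fp L) L (IsCMField.complexConj L) (n + n) (hermD L e dV hdV dW hdW)) :
    (∀ (w : {w : InfinitePlace L // w.IsComplex}) (i j : Fin (n + n)),
        (w.1.embedding (hermD L e dV hdV dW hdW i i)).re * (w.1.embedding (hermD L e dV hdV dW hdW j j)).re < 0 →
        (((UnitaryGroup.archPiEquivCM (n + n) L (hermD L e dV hdV dW hdW) x w :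
            UnitaryGroup.archLocal L (n + n) (hermD L e dV hdV dW hdW) w) : GL (Fin (n + n)) ℂ) : Matrix (Fin (n + n)) (Fin (n + n)) ℂ) i j = 0) ↔
      ∀ σ : {v : InfinitePlace (Fp L) // v.IsReal}, archUFormPi L (IsCMField.complexConj L) (n + n) (IsCMField.complexConj_ne_one L) (cmPlaceOver L) (cmPlaceOver_smul L) (cmPlaceOver_comap L) (fun k => Sum.elim (cmGramEntry L e dV hdV dW hdW) (-cmGramEntry L e dV hdV dW hdW) ((LocalSplitting.e₂ n).symm k))
        (gramD_gram_realDiagonal_entry_ne_zero L e dV hdV dW hdW hdV0 hdW0) (gramD_eq_diagonal_cm L e dV hdV dW hdW) (J := hermD L e dV hdV dW hdW) rfl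
        (complexConj_imagUnit L) (imagUnit_ne_zero L) x σ ∈
        (UForm.kV (PosIdx (signVec (cmPlaceOver L) (fun k => Sum.elim (cmGramEntry L e dV hdV dW hdW) (-cmGramEntry L e dV hdV dW hdW) ((LocalSplitting.e₂ n).symm k)) (imagUnit L) σ)) (NegIdx (signVec (cmPlaceOver L) (fun k => Sum.elim (cmGramEntry L e dV hdV dW hdW) (-cmGramEntry L e dV hdV dW hdW) ((LocalSplitting.e₂ n).symm k)) (imagUnit L) σ))).range := by
  have hD0 := sqrtAbs_signVec_ne_zero (IsCMField.complexConj_ne_one L) (cmPlaceOver_smul L) (complexConj_imagUnit L) (imagUnit_ne_zero L)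
    (gramD_gram_realDiagonal_entry_ne_zero L e dV hdV dW hdW hdV0 hdW0)
  constructor
  · intro h σ
    rw [mem_kV_range_iff_toBlocks, coe_archUFormPi_eq_reindex L e dV hdV hdV0 dW hdW hdW0]
    constructor
    · ext a b
      have hab := h (cmPlaceOver L σ) a.1 b.1 ((re_mul_re_neg_iff L e dV hdV hdV0 dW hdW hdW0 σ a.1 b.1).2 ⟨fun _ => b.2, fun _ => a.2⟩)
      simp only [Matrix.toBlocks₁₂, Matrix.of_apply, Matrix.reindex_apply, Matrix.submatrix_apply, signSplit, Equiv.symm_symm,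
        Equiv.sumCompl_apply_inl, Equiv.sumCompl_apply_inr, scaleConj_apply, Matrix.zero_apply]
      rw [hab, mul_zero, zero_mul]
    · ext a b
      have hab := h (cmPlaceOver L σ) a.1 b.1 ((re_mul_re_neg_iff L e dV hdV hdV0 dW hdW hdW0 σ a.1 b.1).2
        ⟨fun ha => absurd ha a.2, fun hb => absurd b.2 hb⟩)
      simp only [Matrix.toBlocks₂₁, Matrix.of_apply, Matrix.reindex_apply, Matrix.submatrix_apply, signSplit, Equiv.symm_symm,
        Equiv.sumCompl_apply_inl, Equiv.sumCompl_apply_inr, scaleConj_apply, Matrix.zero_apply]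
      rw [hab, mul_zero, zero_mul]
  · intro h w i j hij
    obtain ⟨σ, rfl⟩ := exists_cmPlaceOver_eq L w
    obtain ⟨h₁₂, h₂₁⟩ := (mem_kV_range_iff_toBlocks _).1 (h σ)
    rw [coe_archUFormPi_eq_reindex L e dV hdV hdV0 dW hdW hdW0] at h₁₂ h₂₁
    rw [re_mul_re_neg_iff L e dV hdV hdV0 dW hdW hdW0] at hij
    by_cases hi : 0 < (signVec (cmPlaceOver L) (fun k => Sum.elim (cmGramEntry L e dV hdV dW hdW) (-cmGramEntry L e dV hdV dW hdW) ((LocalSplitting.e₂ n).symm k)) (imagUnit L) σ) i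
    · have hj : ¬ 0 < (signVec (cmPlaceOver L) (fun k => Sum.elim (cmGramEntry L e dV hdV dW hdW) (-cmGramEntry L e dV hdV dW hdW) ((LocalSplitting.e₂ n).symm k)) (imagUnit L) σ) j := hij.1 hi
      have hab := congrFun (congrFun h₁₂ ⟨i, hi⟩) ⟨j, hj⟩
      simp only [Matrix.toBlocks₁₂, Matrix.of_apply, Matrix.reindex_apply, Matrix.submatrix_apply, signSplit, Equiv.symm_symm,
        Equiv.sumCompl_apply_inl, Equiv.sumCompl_apply_inr, scaleConj_apply, Matrix.zero_apply] at hab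
      rcases mul_eq_zero.1 hab with hab | hab
      · rcases mul_eq_zero.1 hab with hab | hab
        · exact absurd hab (Complex.ofReal_ne_zero.2 (hD0 σ i))
        · exact hab
      · exact absurd hab (inv_ne_zero (Complex.ofReal_ne_zero.2 (hD0 σ j)))
    · have hj : 0 < (signVec (cmPlaceOver L) (fun k => Sum.elim (cmGramEntry L e dV hdV dW hdW) (-cmGramEntry L e dV hdV dW hdW) ((LocalSplitting.e₂ n).symm k)) (imagUnit L) σ) j := not_not.1 fun hj => hi (hij.2 hj)
      have hab := congrFun (congrFun h₂₁ ⟨i, hi⟩) ⟨j, hj⟩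
      simp only [Matrix.toBlocks₂₁, Matrix.of_apply, Matrix.reindex_apply, Matrix.submatrix_apply, signSplit, Equiv.symm_symm,
        Equiv.sumCompl_apply_inl, Equiv.sumCompl_apply_inr, scaleConj_apply, Matrix.zero_apply] at hab
      rcases mul_eq_zero.1 hab with hab | hab
      · rcases mul_eq_zero.1 hab with hab | hab
        · exact absurd hab (Complex.ofReal_ne_zero.2 (hD0 σ i))
        · exact hab
      · exact absurd hab (inv_ne_zero (Complex.ofReal_ne_zero.2 (hD0 σ j)))

/-! ## §3 The `kV`-range clause ⟺ membership in the submonoid generated by the place sections -/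

include hdV0 hdW0 in
/-- place sections at DIFFERENT real places commute (their sign-frame components are `Pi.mulSingle`s, ★ `archUFormPi_placeSec`, and `archUFormPi` is injective,
★ `archUFormPi_injective_cm`). [cite: BorelJacquet1979, §4.1] -/
theorem commute_placeSec_of_ne {σ σ' : {v : InfinitePlace (Fp L) // v.IsReal}} (hne : σ ≠ σ')
    (u : UForm (PosIdx (signVec (cmPlaceOver L) (fun k => Sum.elim (cmGramEntry L e dV hdV dW hdW) (-cmGramEntry L e dV hdV dW hdW) ((LocalSplitting.e₂ n).symm k)) (imagUnit L) σ)) (NegIdx (signVec (cmPlaceOver L) (fun k => Sum.elim (cmGramEntry L e dV hdV dW hdW) (-cmGramEntry L e dV hdV dW hdW) ((LocalSplitting.e₂ n).symm k)) (imagUnit L) σ))) (u' : UForm (PosIdx (signVec (cmPlaceOver L) (fun k => Sum.elim (cmGramEntry L e dV hdV dW hdW) (-cmGramEntry L e dV hdV dW hdW) ((LocalSplitting.e₂ n).symm k)) (imagUnit L) σ')) (NegIdx (signVec (cmPlaceOver L) (fun k => Sum.elim (cmGramEntry L e dV hdV dW hdW) (-cmGramEntry L e dV hdV dW hdW) ((LocalSplitting.e₂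 n).symm k)) (imagUnit L) σ'))) :
    Commute (placeSec L (IsCMField.complexConj L) (n + n) (IsCMField.complexConj_ne_one L) (cmPlaceOver L) (cmPlaceOver_smul L) (fun k => Sum.elim (cmGramEntry L e dV hdV dW hdW) (-cmGramEntry L e dV hdV dW hdW) ((LocalSplitting.e₂ n).symm k))
          (gramD_gram_realDiagonal_entry_ne_zero L e dV hdV dW hdW hdV0 hdW0) (complexConj_imagUnit L) (imagUnit_ne_zero L) σ
          (cmPlaceOver_comap L) (gramD_eq_diagonal_cm L e dV hdV dW hdW) (J := hermD L e dV hdV dW hdW) rfl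
          (complexConj_smul_infinitePlace L) u)
      (placeSec L (IsCMField.complexConj L) (n + n) (IsCMField.complexConj_ne_one L) (cmPlaceOver L) (cmPlaceOver_smul L) (fun k => Sum.elim (cmGramEntry L e dV hdV dW hdW) (-cmGramEntry L e dV hdV dW hdW) ((LocalSplitting.e₂ n).symm k))
          (gramD_gram_realDiagonal_entry_ne_zero L e dV hdV dW hdW hdV0 hdW0) (complexConj_imagUnit L) (imagUnit_ne_zero L) σ'
          (cmPlaceOver_comap L) (gramD_eq_diagonal_cm L e dV hdV dW hdW) (J := hermD L e dV hdV dW hdW) rfl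
          (complexConj_smul_infinitePlace L) u') := by
  unfold Commute SemiconjBy
  apply archUFormPi_injective_cm L (fun k => Sum.elim (cmGramEntry L e dV hdV dW hdW) (-cmGramEntry L e dV hdV dW hdW) ((LocalSplitting.e₂ n).symm k))
    (gramD_gram_realDiagonal_entry_ne_zero L e dV hdV dW hdW hdV0 hdW0) (gramD_eq_diagonal_cm L e dV hdV dW hdW) (J := hermD L e dV hdV dW hdW) rfl
  rw [map_mul, map_mul, archUFormPi_placeSec L (IsCMField.complexConj L) (n + n) (IsCMField.complexConj_ne_one L) (cmPlaceOver L) (cmPlaceOver_smul L) (fun k => Sum.elim (cmGramEntry L e dV hdV dW hdW) (-cmGramEntry L e dV hdV dW hdW) ((LocalSplitting.e₂ n).symm k))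
      (gramD_gram_realDiagonal_entry_ne_zero L e dV hdV dW hdW hdV0 hdW0) (complexConj_imagUnit L) (imagUnit_ne_zero L) σ (cmPlaceOver_comap L)
      (gramD_eq_diagonal_cm L e dV hdV dW hdW) (J := hermD L e dV hdV dW hdW) rfl (complexConj_smul_infinitePlace L) u,
    archUFormPi_placeSec L (IsCMField.complexConj L) (n + n) (IsCMField.complexConj_ne_one L) (cmPlaceOver L) (cmPlaceOver_smul L) (fun k => Sum.elim (cmGramEntry L e dV hdV dW hdW) (-cmGramEntry L e dV hdV dW hdW) ((LocalSplitting.e₂ n).symm k))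
      (gramD_gram_realDiagonal_entry_ne_zero L e dV hdV dW hdW hdV0 hdW0) (complexConj_imagUnit L) (imagUnit_ne_zero L) σ' (cmPlaceOver_comap L)
      (gramD_eq_diagonal_cm L e dV hdV dW hdW) (J := hermD L e dV hdV dW hdW) rfl (complexConj_smul_infinitePlace L) u']
  exact (Pi.mulSingle_commute (f := fun v : {v : InfinitePlace (Fp L) // v.IsReal} => UForm (PosIdx (signVec (cmPlaceOver L) (fun k => Sum.elim (cmGramEntry L e dV hdV dW hdW) (-cmGramEntry L e dV hdV dW hdW) ((LocalSplitting.e₂ n).symm k)) (imagUnit L) v)) (NegIdx (signVec (cmPlaceOver L) (fun k => Sum.elim (cmGramEntry L e dV hdV dW hdW) (-cmGramEntry L e dV hdV dW hdW) ((LocalSplitting.e₂ n).symm k)) (imagUnit L) v))) hne u u').eq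

include hdV0 hdW0 in
/-- **the `kV`-range clause ⟺ membership in `Submonoid.closure {placeSec σ (kV k₁)}`** (σ15's ∕ ★ p861314's `hK₀` currency): «⇐» by induction over the closure
(★ `archUFormPi_placeSec` = `Pi.mulSingle`), «⇒» because `x` IS the product over the real places of the place sections of its components (★ `archUFormPi_injective_cm`,
Mathlib `Finset.noncommProd_mulSingle`). [cite: BorelJacquet1979, §4.1] [cite: KonnoKonno2007, §3.1] -/
theorem archUFormPi_mem_range_iff_mem_closure (x : UnitaryGroup.arch (Fp L) L (IsCMField.complexConj L) (n + n) (hermD L e dV hdV dW hdW)) :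
    (∀ σ : {v : InfinitePlace (Fp L) // v.IsReal}, archUFormPi L (IsCMField.complexConj L) (n + n) (IsCMField.complexConj_ne_one L) (cmPlaceOver L) (cmPlaceOver_smul L) (cmPlaceOver_comap L) (fun k => Sum.elim (cmGramEntry L e dV hdV dW hdW) (-cmGramEntry L e dV hdV dW hdW) ((LocalSplitting.e₂ n).symm k))
        (gramD_gram_realDiagonal_entry_ne_zero L e dV hdV dW hdW hdV0 hdW0) (gramD_eq_diagonal_cm L e dV hdV dW hdW) (J := hermD L e dV hdV dW hdW) rfl
        (complexConj_imagUnit L) (imagUnit_ne_zero L) x σ ∈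
        (UForm.kV (PosIdx (signVec (cmPlaceOver L) (fun k => Sum.elim (cmGramEntry L e dV hdV dW hdW) (-cmGramEntry L e dV hdV dW hdW) ((LocalSplitting.e₂ n).symm k)) (imagUnit L) σ)) (NegIdx (signVec (cmPlaceOver L) (fun k => Sum.elim (cmGramEntry L e dV hdV dW hdW) (-cmGramEntry L e dV hdV dW hdW) ((LocalSplitting.e₂ n).symm k)) (imagUnit L) σ))).range) ↔
      x ∈ Submonoid.closure {k : UnitaryGroup.arch (Fp L) L (IsCMField.complexConj L) (n + n) (hermD L e dV hdV dW hdW) |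
        ∃ (σ : {v : InfinitePlace (Fp L) // v.IsReal}) (k₁ : Matrix.unitaryGroup (PosIdx (signVec (cmPlaceOver L) (fun k => Sum.elim (cmGramEntry L e dV hdV dW hdW) (-cmGramEntry L e dV hdV dW hdW) ((LocalSplitting.e₂ n).symm k)) (imagUnit L) σ)) ℂ × Matrix.unitaryGroup (NegIdx (signVec (cmPlaceOver L) (fun k => Sum.elim (cmGramEntry L e dV hdV dW hdW) (-cmGramEntry L e dV hdV dW hdW) ((LocalSplitting.e₂ n).symm k)) (imagUnit L) σ)) ℂ),
          k = placeSec L (IsCMField.complexConj L) (n + n) (IsCMField.complexConj_ne_one L) (cmPlaceOver L) (cmPlaceOver_smul L) (fun k => Sum.elim (cmGramEntry L e dV hdV dW hdW) (-cmGramEntry L e dV hdV dW hdW) ((LocalSplitting.e₂ n).symm k))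
          (gramD_gram_realDiagonal_entry_ne_zero L e dV hdV dW hdW hdV0 hdW0) (complexConj_imagUnit L) (imagUnit_ne_zero L) σ
          (cmPlaceOver_comap L) (gramD_eq_diagonal_cm L e dV hdV dW hdW) (J := hermD L e dV hdV dW hdW) rfl
          (complexConj_smul_infinitePlace L) (UForm.kV _ _ k₁)} := by
  constructor
  · intro h
    choose k hk using h
    have hinj := archUFormPi_injective_cm L (fun k => Sum.elim (cmGramEntry L e dV hdV dW hdW) (-cmGramEntry L e dV hdV dW hdW) ((LocalSplitting.e₂ n).symm k)) (gramD_gram_realDiagonal_entry_ne_zero L e dV hdV dW hdW hdV0 hdW0)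
      (gramD_eq_diagonal_cm L e dV hdV dW hdW) (J := hermD L e dV hdV dW hdW) rfl
    have hcomm : ((Finset.univ : Finset {v : InfinitePlace (Fp L) // v.IsReal}) : Set {v : InfinitePlace (Fp L) // v.IsReal}).Pairwise fun σ σ' =>
        Commute (placeSec L (IsCMField.complexConj L) (n + n) (IsCMField.complexConj_ne_one L) (cmPlaceOver L) (cmPlaceOver_smul L) (fun k => Sum.elim (cmGramEntry L e dV hdV dW hdW) (-cmGramEntry L e dV hdV dW hdW) ((LocalSplitting.e₂ n).symm k))
          (gramD_gram_realDiagonal_entry_ne_zero L e dV hdV dW hdW hdV0 hdW0) (complexConj_imagUnit L) (imagUnit_ne_zero L) σ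
          (cmPlaceOver_comap L) (gramD_eq_diagonal_cm L e dV hdV dW hdW) (J := hermD L e dV hdV dW hdW) rfl
          (complexConj_smul_infinitePlace L) (UForm.kV _ _ (k σ)))
          (placeSec L (IsCMField.complexConj L) (n + n) (IsCMField.complexConj_ne_one L) (cmPlaceOver L) (cmPlaceOver_smul L) (fun k => Sum.elim (cmGramEntry L e dV hdV dW hdW) (-cmGramEntry L e dV hdV dW hdW) ((LocalSplitting.e₂ n).symm k))
          (gramD_gram_realDiagonal_entry_ne_zero L e dV hdV dW hdW hdV0 hdW0) (complexConj_imagUnit L) (imagUnit_ne_zero L) σ'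
          (cmPlaceOver_comap L) (gramD_eq_diagonal_cm L e dV hdV dW hdW) (J := hermD L e dV hdV dW hdW) rfl
          (complexConj_smul_infinitePlace L) (UForm.kV _ _ (k σ'))) :=
      fun σ _ σ' _ hne => commute_placeSec_of_ne L e dV hdV hdV0 dW hdW hdW0 hne _ _
    have hmem : (Finset.univ.noncommProd (fun σ => placeSec L (IsCMField.complexConj L) (n + n) (IsCMField.complexConj_ne_one L) (cmPlaceOver L) (cmPlaceOver_smul L) (fun k => Sum.elim (cmGramEntry L e dV hdV dW hdW) (-cmGramEntry L e dV hdV dW hdW) ((LocalSplitting.e₂ n).symm k))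
          (gramD_gram_realDiagonal_entry_ne_zero L e dV hdV dW hdW hdV0 hdW0) (complexConj_imagUnit L) (imagUnit_ne_zero L) σ
          (cmPlaceOver_comap L) (gramD_eq_diagonal_cm L e dV hdV dW hdW) (J := hermD L e dV hdV dW hdW) rfl
          (complexConj_smul_infinitePlace L) (UForm.kV _ _ (k σ))) hcomm) ∈
        Submonoid.closure {k : UnitaryGroup.arch (Fp L) L (IsCMField.complexConj L) (n + n) (hermD L e dV hdV dW hdW) |
          ∃ (σ : {v : InfinitePlace (Fp L) // v.IsReal}) (k₁ : Matrix.unitaryGroup (PosIdx (signVec (cmPlaceOver L) (fun k => Sum.elim (cmGramEntry L e dV hdV dW hdW) (-cmGramEntry L e dV hdV dW hdW) ((LocalSplitting.e₂ n).symm k)) (imagUnit L) σ)) ℂ × Matrix.unitaryGroup (NegIdx (signVec (cmPlaceOver L) (fun k => Sum.elim (cmGramEntry L e dV hdV dW hdW) (-cmGramEntry L e dV hdV dW hdW) ((LocalSplitting.e₂ n).symm k)) (imagUnit L) σ)) ℂ),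
            k = placeSec L (IsCMField.complexConj L) (n + n) (IsCMField.complexConj_ne_one L) (cmPlaceOver L) (cmPlaceOver_smul L) (fun k => Sum.elim (cmGramEntry L e dV hdV dW hdW) (-cmGramEntry L e dV hdV dW hdW) ((LocalSplitting.e₂ n).symm k))
          (gramD_gram_realDiagonal_entry_ne_zero L e dV hdV dW hdW hdV0 hdW0) (complexConj_imagUnit L) (imagUnit_ne_zero L) σ
          (cmPlaceOver_comap L) (gramD_eq_diagonal_cm L e dV hdV dW hdW) (J := hermD L e dV hdV dW hdW) rfl
          (complexConj_smul_infinitePlace L) (UForm.kV _ _ k₁)} :=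
      Submonoid.noncommProd_mem _ _ _ hcomm fun σ _ => Submonoid.subset_closure ⟨σ, k σ, rfl⟩
    have hxy : x = Finset.univ.noncommProd (fun σ => placeSec L (IsCMField.complexConj L) (n + n) (IsCMField.complexConj_ne_one L) (cmPlaceOver L) (cmPlaceOver_smul L) (fun k => Sum.elim (cmGramEntry L e dV hdV dW hdW) (-cmGramEntry L e dV hdV dW hdW) ((LocalSplitting.e₂ n).symm k))
          (gramD_gram_realDiagonal_entry_ne_zero L e dV hdV dW hdW hdV0 hdW0) (complexConj_imagUnit L) (imagUnit_ne_zero L) σ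
          (cmPlaceOver_comap L) (gramD_eq_diagonal_cm L e dV hdV dW hdW) (J := hermD L e dV hdV dW hdW) rfl
          (complexConj_smul_infinitePlace L) (UForm.kV _ _ (k σ))) hcomm := by
      apply hinj
      rw [Finset.map_noncommProd, Finset.noncommProd_congr rfl (fun σ _ => archUFormPi_placeSec L (IsCMField.complexConj L) (n + n)
        (IsCMField.complexConj_ne_one L) (cmPlaceOver L) (cmPlaceOver_smul L) (fun k => Sum.elim (cmGramEntry L e dV hdV dW hdW) (-cmGramEntry L e dV hdV dW hdW) ((LocalSplitting.e₂ n).symm k))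
        (gramD_gram_realDiagonal_entry_ne_zero L e dV hdV dW hdW hdV0 hdW0) (complexConj_imagUnit L) (imagUnit_ne_zero L) σ (cmPlaceOver_comap L)
        (gramD_eq_diagonal_cm L e dV hdV dW hdW) (J := hermD L e dV hdV dW hdW) rfl (complexConj_smul_infinitePlace L) (UForm.kV _ _ (k σ))),
        Finset.noncommProd_mulSingle]
      exact funext fun σ => (hk σ).symm
    rw [hxy]
    exact hmem
  · intro hx
    induction hx using Submonoid.closure_induction with
    | mem k hk =>
      obtain ⟨σ₀, k₁, rfl⟩ := hk
      intro σ
      rw [archUFormPi_placeSec L (IsCMField.complexConj L) (n + n) (IsCMField.complexConj_ne_one L) (cmPlaceOver L) (cmPlaceOver_smul L) (fun k => Sum.elim (cmGramEntry L e dV hdV dW hdW) (-cmGramEntry L e dV hdV dW hdW) ((LocalSplitting.e₂ n).symm k))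
      (gramD_gram_realDiagonal_entry_ne_zero L e dV hdV dW hdW hdV0 hdW0) (complexConj_imagUnit L) (imagUnit_ne_zero L) σ₀ (cmPlaceOver_comap L)
      (gramD_eq_diagonal_cm L e dV hdV dW hdW) (J := hermD L e dV hdV dW hdW) rfl (complexConj_smul_infinitePlace L) (UForm.kV _ _ k₁)]
      by_cases hσ : σ = σ₀
      · subst hσ
        rw [Pi.mulSingle_eq_same]
        exact ⟨k₁, rfl⟩
      · rw [Pi.mulSingle_eq_of_ne hσ]
        exact one_mem _
    | one => intro σ; rw [map_one, Pi.one_apply]; exact one_mem _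
    | mul k₁ k₂ _ _ ih₁ ih₂ => intro σ; rw [map_mul, Pi.mul_apply]; exact mul_mem (ih₁ σ) (ih₂ σ)

/-! ## §4 The composite: SignBlock ⟺ membership in the place-section submonoid -/

include hdV0 hdW0 in
/-- **SignBlock ⟺ `x ∈ Submonoid.closure {placeSec σ (kV k₁)}`** — ★ B2's `K_diag` currency IS σ15's ∕ ★ p861314's `hK₀` currency; with ★ B2 `exists_conj_archCompact`:
for every standard Iwasawa datum, `archToAdelic a ∈ 𝒦.K ↔ g⁻¹ a g ∈ Submonoid.closure {placeSec σ (kV k₁)}`. [cite: Weil1964, Chap. I n° 8] [cite: BorelJacquet1979, §4.1] -/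
theorem signBlock_iff_mem_closure (x : UnitaryGroup.arch (Fp L) L (IsCMField.complexConj L) (n + n) (hermD L e dV hdV dW hdW)) :
    (∀ (w : {w : InfinitePlace L // w.IsComplex}) (i j : Fin (n + n)),
        (w.1.embedding (hermD L e dV hdV dW hdW i i)).re * (w.1.embedding (hermD L e dV hdV dW hdW j j)).re < 0 →
        (((UnitaryGroup.archPiEquivCM (n + n) L (hermD L e dV hdV dW hdW) x w :
            UnitaryGroup.archLocal L (n + n) (hermD L e dV hdV dW hdW) w) : GL (Fin (n + n)) ℂ) : Matrix (Fin (n + n)) (Fin (n + n)) ℂ) i j = 0) ↔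
      x ∈ Submonoid.closure {k : UnitaryGroup.arch (Fp L) L (IsCMField.complexConj L) (n + n) (hermD L e dV hdV dW hdW) |
        ∃ (σ : {v : InfinitePlace (Fp L) // v.IsReal}) (k₁ : Matrix.unitaryGroup (PosIdx (signVec (cmPlaceOver L) (fun k => Sum.elim (cmGramEntry L e dV hdV dW hdW) (-cmGramEntry L e dV hdV dW hdW) ((LocalSplitting.e₂ n).symm k)) (imagUnit L) σ)) ℂ × Matrix.unitaryGroup (NegIdx (signVec (cmPlaceOver L) (fun k => Sum.elim (cmGramEntry L e dV hdV dW hdW) (-cmGramEntry L e dV hdV dW hdW) ((LocalSplitting.e₂ n).symm k)) (imagUnit L) σ)) ℂ),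
          k = placeSec L (IsCMField.complexConj L) (n + n) (IsCMField.complexConj_ne_one L) (cmPlaceOver L) (cmPlaceOver_smul L) (fun k => Sum.elim (cmGramEntry L e dV hdV dW hdW) (-cmGramEntry L e dV hdV dW hdW) ((LocalSplitting.e₂ n).symm k))
          (gramD_gram_realDiagonal_entry_ne_zero L e dV hdV dW hdW hdV0 hdW0) (complexConj_imagUnit L) (imagUnit_ne_zero L) σ
          (cmPlaceOver_comap L) (gramD_eq_diagonal_cm L e dV hdV dW hdW) (J := hermD L e dV hdV dW hdW) rfl
          (complexConj_smul_infinitePlace L) (UForm.kV _ _ k₁)} :=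
  (signBlock_iff_archUFormPi_mem_range L e dV hdV hdV0 dW hdW hdW0 x).trans (archUFormPi_mem_range_iff_mem_closure L e dV hdV hdV0 dW hdW hdW0 x)

include hdV0 hdW0 in
/-- **THE CONJUGACY IN σ15's CURRENCY**: for every STANDARD Iwasawa datum there is `g ∈ H(L⁺ ⊗ ℝ)` with `(a, 1_f) ∈ 𝒦.K ↔ g⁻¹ a g ∈ Submonoid.closure {placeSec σ (kV k₁)}`
(★ B2 `exists_conj_archCompact` + §4). [cite: Weil1964, Chap. I n° 8] [cite: PlatonovRapinchuk1994, §3.2] [cite: BorelJacquet1979, §4.1] -/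
theorem exists_conj_archCompact_closure {𝒦 : IwasawaDatum L e dV hdV dW hdW} (h𝒦 : 𝒦.IsStd) :
    ∃ g : UnitaryGroup.arch (Fp L) L (IsCMField.complexConj L) (n + n) (hermD L e dV hdV dW hdW), ∀ a : UnitaryGroup.arch (Fp L) L (IsCMField.complexConj L) (n + n) (hermD L e dV hdV dW hdW),
      (UnitaryGroup.archToAdelic (Fp L) L (IsCMField.complexConj L) (n + n) (hermD L e dV hdV dW hdW) a : HA L e dV hdV dW hdW) ∈ 𝒦.K ↔
        (g⁻¹ * a * g) ∈ Submonoid.closure {k : UnitaryGroup.arch (Fp L) L (IsCMField.complexConj L) (n + n) (hermD L e dV hdV dW hdW) |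
          ∃ (σ : {v : InfinitePlace (Fp L) // v.IsReal}) (k₁ : Matrix.unitaryGroup (PosIdx (signVec (cmPlaceOver L) (fun k => Sum.elim (cmGramEntry L e dV hdV dW hdW) (-cmGramEntry L e dV hdV dW hdW) ((LocalSplitting.e₂ n).symm k)) (imagUnit L) σ)) ℂ × Matrix.unitaryGroup (NegIdx (signVec (cmPlaceOver L) (fun k => Sum.elim (cmGramEntry L e dV hdV dW hdW) (-cmGramEntry L e dV hdV dW hdW) ((LocalSplitting.e₂ n).symm k)) (imagUnit L) σ)) ℂ),
            k = placeSec L (IsCMField.complexConj L) (n + n) (IsCMField.complexConj_ne_one L) (cmPlaceOver L) (cmPlaceOver_smul L) (fun k => Sum.elim (cmGramEntry L e dV hdV dW hdW) (-cmGramEntry L e dV hdV dW hdW) ((LocalSplitting.e₂ n).symm k))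
            (gramD_gram_realDiagonal_entry_ne_zero L e dV hdV dW hdW hdV0 hdW0) (complexConj_imagUnit L) (imagUnit_ne_zero L) σ
            (cmPlaceOver_comap L) (gramD_eq_diagonal_cm L e dV hdV dW hdW) (J := hermD L e dV hdV dW hdW) rfl
            (complexConj_smul_infinitePlace L) (UForm.kV _ _ k₁)} := by
  obtain ⟨g, hg⟩ := K2LiuStdArchCompactConjugate.exists_conj_archCompact L e dV hdV hdV0 dW hdW hdW0 h𝒦
  exact ⟨g, fun a => (hg a).trans (signBlock_iff_mem_closure L e dV hdV hdV0 dW hdW hdW0 (g⁻¹ * a * g))⟩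

end CM

end Summit.HodgeConjecture.HodgeConjecture.Cruxes.HLiu418.K2LiuSignBlockCompactPlaceSec

end
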